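import Literature.AlgebraicGeometry.ModuliOfAbelianVarieties.SiegelModuliTower
import Literature.AlgebraicGeometry.ModuliOfAbelianVarieties.SiegelFineModuliDeformationBridge
import Literature.AlgebraicGeometry.ModuliOfAbelianVarieties.SiegelAdmissibleOfIsoTriple
import Literature.AlgebraicGeometry.ModuliOfAbelianVarieties.SiegelAdmissibleOfIsoId
import Literature.AlgebraicGeometry.AbelianSchemes.LevelStructureTransportIso
import Literature.AlgebraicGeometry.AbelianSchemes.AbelianSchemeOverMulNEtale
import Literature.AlgebraicGeometry.AbelianSchemes.PolarizationClausesOfThickening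
import Literature.AlgebraicGeometry.AbelianSchemes.PolarizedAbelianSchemeWithLevelBaseChangeUnique
import Literature.AlgebraicGeometry.AbelianSchemes.AbelianSchemeSymplecticLevelTransfer
import Literature.AlgebraicGeometry.Morphisms.EtaleLiftDualNumber
import Mathlib.RingTheory.DualNumber
import HarnessLib

/-!
# The Siegel moduli tower lifts points along nilpotent thickenings (`tr` lifts `ℂ[ε]`-points)

Topic `Literature/AlgebraicGeometry/ModuliOfAbelianVarieties`; theorems only (no definition, no named
fact, no instance). For the transition morphism `tr : 𝓜_K → 𝓜_{K′}` of the tower of fine moduli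
schemes (★ `SiegelModuliTower.tr`, [MumfordFogartyKirwan1994] App. 7A «as a tower with respect to finite
morphisms `𝒜_{nm} → 𝒜_n`»; [Deligne1971TravauxShimura] 4.16–4.17) and a nilpotent thickening
`ι : Spec ℂ ⟶ T` of the point (a `ℚ`-morphism whose underlying map is a surjective closed immersion,
`T` locally noetherian — e.g. `Spec ℂ ⟶ Spec ℂ[ε]`): every commutative square
```
Spec ℂ --s′--> 𝓜_K
  |ι             |tr
  v              v
  T  ----τ---> 𝓜_{K′}
```
has a diagonal `σ : T ⟶ 𝓜_K` with `ι ≫ σ = s′` and `σ ≫ tr = τ` («`tr` is formally smooth at every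
`ℂ`-point», the infinitesimal road (R4) of the cell's Hecke-link line). Proof (fine-moduli
bookkeeping, no new geometry): `τ` classifies a level-`N′` triple `P′` over `T` whose fibre along `ι`
is isomorphic — as a triple — to the level change `Q′` of the level-`N` triple `Q` classified by `s′`
(★ `exists_triple_of_comp_eq_classifyingMap`, ★ `classifyingMap_comp_tr`); the level-`N` structure of
`Q` moves along that isomorphism of triples (★ `LevelStructure.exists_comp_of_iso`; its symplectic
clause by ★ `IsBaseChangeVia.hpol` + ★ (T1)/(T0)) to the fibre of `P′`, lifts UNIQUELY to a level-`N`
structure `ψ` on `P′` along the thickening (E5: ★ `LevelStructure.existsUnique_baseChange_eq_of_charZero`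
— `[N]` is étale, [SGA1] I 5.6), `ψ` is symplectic-liftable by ★
`IsSymplecticLiftable.of_baseChange_of_surjective`, and E5 uniqueness at level `N′` gives
`ψ^{d} = P′.level`; the classifying morphism of `(P′.A, P′.λ, ψ)` is the diagonal.

* `isSymplecticLiftable_of_comp_iso` — symplectic-liftability moves along an isomorphism of triples
  over the same base together with the level sections;
* `exists_lift_of_isClosedImmersion_of_surjective` — the square lemma for any thickening `ι` of the
  point;
* `exists_lift_dualNumber` — the `Spec ℂ ⟶ Spec ℂ[ε]` form (socket text of the (R4-δ) consumer).

## References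
* [MumfordFogartyKirwan1994] D. Mumford, J. Fogarty, F. Kirwan, *Geometric Invariant Theory*, 3rd ed.,
  Ch. 7 §2 Def. 7.1–7.3 (p. 129), §3 Thm. 7.9 (p. 139), App. 7A (p. 235).
* [Deligne1971TravauxShimura] P. Deligne, *Travaux de Shimura*, 4.16–4.17 (p. 150).
* [SGA1] A. Grothendieck, *SGA 1*, Exp. I Cor. 5.6 (étale ⇒ unique infinitesimal lifting).
* [Lan2013PELCompactifications] K.-W. Lan, §1.3.6 Lemma 1.3.6.6 (liftability is fibrewise).
-/

noncomputable section

open CategoryTheory CategoryTheory.Limits AlgebraicGeometry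
open scoped DualNumber MonObj

universe u

namespace Literature.AlgebraicGeometry.AbelianSchemes

namespace PolarizedAbelianSchemeWithLevel

open Literature.AlgebraicGeometry.Motives
open AbelianSchemeOver

variable {g N n : ℕ} {δ : Fin g → ℕ} {S : Scheme.{u}} {P₁ P₂ : PolarizedAbelianSchemeWithLevel g N δ S}

/-- For an isomorphism `φ : X ≅ Y` of abelian varieties: if `φ` carries `x` to `y` then `φ⁻¹` carries
`y` to `x`. [folklore] -/
private theorem map_inv_eq_of_map_hom_eq {K : Type u} [Field K] {X Y : AbelianVariety K} (φ : X ≅ Y)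
    {Ω : Type u} [Field Ω] [Algebra K Ω] {x : AlgPoints X.X Ω} {y : AlgPoints Y.X Ω}
    (h : AlgPoints.map φ.hom.hom.hom.hom x = y) : AlgPoints.map φ.inv.hom.hom.hom y = x := by
  rw [← h]
  change (x ≫ φ.hom.hom.hom.hom) ≫ φ.inv.hom.hom.hom = x
  have hφ : φ.hom.hom.hom.hom ≫ φ.inv.hom.hom.hom = 𝟙 _ :=
    congrArg (fun ψ => ψ.hom.hom.hom) φ.hom_inv_id
  rw [Category.assoc, hφ, Category.comp_id]

/-- **Symplectic-liftability moves along an isomorphism of triples over the same base, together with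
the level sections.** Let `e : X₂ ≅ X₁` be an isomorphism of `S`-group schemes exhibiting `P₂` as
related to `P₁` along `𝟙 S` (`P₂.IsBaseChangeVia P₁ (𝟙 S) e Ĥ`: duals, Poincaré bundles and
polarisations match), let `φ₂` be a level structure on `X₂` symplectic-liftable for `λ₂`, and let `φ₁`
be the level structure on `X₁` with sections `φ₂.σ i ≫ e`. Then `φ₁` is symplectic-liftable for `λ₁`:
at a geometric point `s`, an ample witness `Θ₁` of `λ̄₁` pulls back along `e_s` to an ample witness of
`λ̄₂` (★ `IsBaseChangeVia.hpol`), a symplectic lift there moves back along `e_s⁻¹` (★ (T1)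
`SymplecticLift.nonempty_transport`), and `(e_s⁻¹)^* e_s^* Θ₁ ∼ Θ₁` (★ (T0)).
[cite: Lan2013PELCompactifications, §1.3.6 Lemma 1.3.6.6 (pp. 81–82)]
[cite: MumfordFogartyKirwan1994, Ch. 7 §2 Definition 7.3 (p. 129)] -/
theorem isSymplecticLiftable_of_comp_iso (e : P₂.A.X ≅ P₁.A.X) [IsMonHom e.hom]
    {G : P₂.A.X.left ⟶ P₁.A.X.left} (heG : e.hom.left = G) {Ĥ : P₂.D.hat.X.left ⟶ P₁.D.hat.X.left}
    (hBC : P₂.IsBaseChangeVia P₁ (𝟙 S) G Ĥ) {φ₂ : P₂.A.LevelStructure g n}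
    (h₂ : φ₂.IsSymplecticLiftable P₂.pol δ) {φ₁ : P₁.A.LevelStructure g n}
    (hσ : ∀ i, φ₁.σ i = φ₂.σ i ≫ e.hom) : φ₁.IsSymplecticLiftable P₁.pol δ := by
  subst heG
  intro Ω _ _ s Θ₁ hΘ₁ hlam₁
  haveI := AbelianVariety.isDominant_toSchemeHom_iso_hom (fibreIsoOfIso e s)
  haveI := AbelianVariety.isDominant_toSchemeHom_iso_hom (fibreIsoOfIso e s).symm
  -- the witness moves to the `P₂`-side along `e_s`
  obtain ⟨hΘ₂, hlam₂⟩ := IsBaseChangeVia.hpol e hBC s Θ₁ hΘ₁ hlam₁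
  obtain ⟨Λ₂⟩ := h₂ Ω s _ hΘ₂ hlam₂
  -- the sections match along `e_s⁻¹`
  have he : ∀ i, AlgPoints.map (fibreIsoOfIso e s).symm.hom.hom.hom.hom (P₁.A.restrictPt s (φ₁.σ i)) =
      P₂.A.restrictPt s (φ₂.σ i) := fun i => by
    have hmap := map_fibreIsoOfIso_restrictPt_of_comp_eq e s (φ₂.σ i) (φ₁.σ i)
      (by rw [hσ i, Over.comp_left])
    exact map_inv_eq_of_map_hom_eq (fibreIsoOfIso e s) hmap
  obtain ⟨Λ₁⟩ := Λ₂.nonempty_transport (φ' := φ₁) (fibreIsoOfIso e s).symm he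
  -- `(e_s⁻¹)^* e_s^* Θ₁` is the same divisor as `Θ₁`
  have hsame : ((Θ₁.pullback (AbelianVariety.Hom.toSchemeHom (fibreIsoOfIso e s).hom)).pullback
      (AbelianVariety.Hom.toSchemeHom (fibreIsoOfIso e s).symm.hom)).SameDivisor Θ₁ := by
    refine (Θ₁.pullback_pullback_sameDivisor _ _).trans ?_
    have hcomp : AbelianVariety.Hom.toSchemeHom (fibreIsoOfIso e s).symm.hom ≫
        AbelianVariety.Hom.toSchemeHom (fibreIsoOfIso e s).hom = 𝟙 _ := by
      change AbelianVariety.Hom.toSchemeHom ((fibreIsoOfIso e s).inv ≫ (fibreIsoOfIso e s).hom) = _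
      rw [(fibreIsoOfIso e s).inv_hom_id]
      rfl
    exact (Θ₁.pullback_congr_sameDivisor hcomp).trans Θ₁.pullback_id_sameDivisor
  exact Λ₁.nonempty_of_linEquiv hsame.linEquiv

end PolarizedAbelianSchemeWithLevel

end Literature.AlgebraicGeometry.AbelianSchemes

namespace Literature.AlgebraicGeometry.ModuliOfAbelianVarieties

namespace SiegelModuliTower

open Literature.AlgebraicGeometry.Motives (SchemeOver specOver AlgPoints)
open Literature.AlgebraicGeometry.AbelianSchemes (PolarizedAbelianSchemeWithLevel AbelianSchemeOver)
open Literature.AlgebraicGeometry.AbelianSchemes.AbelianSchemeOver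

variable {g : ℕ} {δ : Fin g → ℕ}

/-- **The tower lifts points along a nilpotent thickening of the point** ([MumfordFogartyKirwan1994]
App. 7A tower; the infinitesimal lifting behind «`𝒜_{nm} → 𝒜_n` is étale»). Let `i₀ : Spec ℂ ⟶ T` be a
`ℚ`-morphism from the point to a locally noetherian `ℚ`-scheme whose underlying map is a surjective
closed immersion, `s′ : Spec ℂ ⟶ 𝓜_K`, `τ : T ⟶ 𝓜_{K′}` with `i₀ ≫ τ = s′ ≫ tr`. Then there is
`σ : T ⟶ 𝓜_K` with `i₀ ≫ σ = s′` and `σ ≫ tr = τ`. [cite: MumfordFogartyKirwan1994, Ch. 7 §3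
Theorem 7.9 (p. 139) and App. 7A (p. 235)] [cite: SGA1, Exp. I Cor. 5.6]
[cite: Deligne1971TravauxShimura, 4.16–4.17 p. 150] -/
theorem exists_lift_of_isClosedImmersion_of_surjective (hg : 0 < g)
    (𝓜 : ∀ K : SiegelLevel δ, SiegelFineModuliScheme g K.N δ) {K K' : SiegelLevel δ} (f : K ⟶ K')
    {T : SchemeOver ℚ} [IsLocallyNoetherian T.left] (i₀ : specOver ℚ ℂ ⟶ T)
    [IsClosedImmersion i₀.left] [Surjective i₀.left] (s' : specOver ℚ ℂ ⟶ (𝓜 K).M)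
    (τ : T ⟶ (𝓜 K').M) (h : i₀ ≫ τ = s' ≫ tr hg 𝓜 f) :
    ∃ σ : T ⟶ (𝓜 K).M, i₀ ≫ σ = s' ∧ σ ≫ tr hg 𝓜 f = τ := by
  haveI := SiegelFineModuliScheme.isLocallyNoetherian_specOver_complex
  haveI := (𝓜 K).isLocallyNoetherian
  haveI := (𝓜 K').isLocallyNoetherian
  have hd := N_eq_mul_div hg f
  have hN := N_ne_zero K
  -- (1) the level-`N` triple `Q` over `Spec ℂ` classified by `s′`
  obtain ⟨Q, G₁, Ĝ₁, hQ⟩ := PolarizedAbelianSchemeWithLevel.exists_isBaseChangeVia (𝓜 K).univ s'.left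
  have hclsQ : (𝓜 K).classifyingMap (specOver ℚ ℂ) Q = s' :=
    ((𝓜 K).eq_classifyingMap (specOver ℚ ℂ) Q s' ⟨G₁, Ĝ₁, hQ⟩).symm
  -- (2) its level change `Q′` is classified by `s′ ≫ tr = i₀ ≫ τ`
  have hclsQ' : i₀ ≫ τ = (𝓜 K').classifyingMap (specOver ℚ ℂ)
      (Q.changeLevel K'.N (K.N / K'.N) hd hN) := by
    rw [h, ← hclsQ]
    exact classifyingMap_comp_tr hg 𝓜 f (specOver ℚ ℂ) Q
  -- (3) the level-`N′` triple `P′` over `T` classified by `τ`, with fibre `Q′` along `i₀`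
  obtain ⟨P', ⟨G₂, Ĝ₂, hP'⟩, H, Ĥ, hfib⟩ :=
    (𝓜 K').exists_triple_of_comp_eq_classifyingMap i₀ (Q.changeLevel K'.N (K.N / K'.N) hd hN) τ hclsQ'
  have hclsP' : (𝓜 K').classifyingMap T P' = τ := (𝓜 K').classifyingMap_eq_of_isBaseChangeVia P' τ hP'
  -- the chosen base change `PB = P′ ×_T Spec ℂ` and the isomorphism of triples `Q′ ≅ PB` over `Spec ℂ`
  have hPB := P'.baseChange_isBaseChangeVia i₀.left
  obtain ⟨HQ, ĤQ, hHQ, -, hHQG, -, hrel⟩ :=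
    PolarizedAbelianSchemeWithLevel.IsBaseChangeVia.exists_isBaseChangeVia_id_of_isBaseChangeVia hPB hfib
  -- `hrel : Q′.IsBaseChangeVia (P′.baseChange i₀.left) (𝟙 _) HQ ĤQ`, `hHQG : HQ ≫ pullback.fst _ _ = H`
  obtain ⟨eQ, heQ, hmon⟩ := exists_iso_of_isBaseChangeVia_id hrel.1.1
  haveI := hmon
  -- (4) move the level-`N` structure of `Q` along `eQ` to `PB.A = P′.A ×_T Spec ℂ`
  -- (`Q′.A` is `Q.A` by construction of `changeLevel`)
  obtain ⟨χ₀, hχ₀⟩ := LevelStructure.exists_comp_of_iso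
    (A₂ := (Q.changeLevel K'.N (K.N / K'.N) hd hN).A) (A₁ := (P'.baseChange i₀.left).A) eQ
    (Q.level : AbelianSchemeOver.LevelStructure g K.N (Q.changeLevel K'.N (K.N / K'.N) hd hN).A)
  have hχ₀symp : χ₀.IsSymplecticLiftable (P'.baseChange i₀.left).pol δ :=
    PolarizedAbelianSchemeWithLevel.isSymplecticLiftable_of_comp_iso (P₂ := Q.changeLevel K'.N
      (K.N / K'.N) hd hN) (P₁ := P'.baseChange i₀.left) eQ heQ hrel Q.symplectic hχ₀
  -- (5) lift `χ₀` along the thickening `i₀` (E5; `[N]` étale in characteristic `0`)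
  obtain ⟨ψ, hψ, hψuniq⟩ := AbelianSchemeOver.LevelStructure.existsUnique_baseChange_eq_of_charZero
    P'.A T.hom hN i₀.left χ₀
  -- `ψ` changed to level `N′` is `P′.level`: both restrict to `χ₀^{d}` along `i₀` (E5 uniqueness at `N′`)
  have hχ₀d : (χ₀.changeLevel K'.N (K.N / K'.N) hd hN) = (P'.baseChange i₀.left).level := by
    apply LevelStructure.ext_σ
    funext i
    rw [LevelStructure.changeLevel_σ, hχ₀ i, ← MonObj.pow_comp]
    -- `(Q.level.σ i ^ d) ≫ eQ = PB.level.σ i` from the level clause of `hrel`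
    ext : 1
    rw [Over.comp_left, heQ]
    have hl := hrel.1.2 i
    rw [Category.id_comp] at hl
    exact hl
  have hψd : ψ.changeLevel K'.N (K.N / K'.N) hd hN = P'.level := by
    have huniq := AbelianSchemeOver.LevelStructure.existsUnique_baseChange_eq_of_charZero P'.A T.hom
      (SiegelModuliTower.N_ne_zero K') i₀.left (χ₀.changeLevel K'.N (K.N / K'.N) hd hN)
    refine huniq.unique ?_ ?_
    · -- `(ψ^{d}).baseChange i₀ = (ψ.baseChange i₀)^{d} = χ₀^{d}`
      apply LevelStructure.ext_σ
      funext i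
      rw [LevelStructure.baseChange_σ, LevelStructure.changeLevel_σ, LevelStructure.changeLevel_σ,
        map_pow, ← LevelStructure.baseChange_σ, hψ]
      rfl
    · rw [hχ₀d]
      rfl
  -- (6) `ψ` is symplectic-liftable for `P′.pol`: its restriction `χ₀` is, and `i₀` is a surjective
  -- closed immersion
  have hψsymp : ψ.IsSymplecticLiftable P'.pol δ := by
    refine AbelianSchemeOver.LevelStructure.IsSymplecticLiftable.of_baseChange_of_surjective P'.A
      i₀.left P'.pol ψ δ ?_
    rw [hψ]
    exact hχ₀symp
  -- (7) the level-`N` triple over `T` and its classifying morphism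
  let Pt : PolarizedAbelianSchemeWithLevel g K.N δ T.left :=
    ⟨P'.A, P'.relDim, P'.D, P'.pol, P'.hasType, ψ, hψsymp, P'.hatNormalised⟩
  -- `Pt` changed to level `N′` is `P′` up to the identity isomorphism of triples, hence has the
  -- same classifying morphism
  have hPt : (𝓜 K').classifyingMap T (Pt.changeLevel K'.N (K.N / K'.N) hd hN) =
      (𝓜 K').classifyingMap T P' := by
    have hrefl := PolarizedAbelianSchemeWithLevel.IsBaseChangeVia.refl P'
    refine ((𝓜 K').classifyingMap_eq_iff_exists_isBaseChangeVia_id _ P').mpr ⟨𝟙 _, 𝟙 _, ?_⟩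
    refine ⟨⟨hrefl.1.1, fun i => ?_⟩, hrefl.2.1, hrefl.2.2.1, hrefl.2.2.2⟩
    change ((ψ.changeLevel K'.N (K.N / K'.N) hd hN).σ i).left ≫ 𝟙 _ = 𝟙 _ ≫ (P'.level.σ i).left
    rw [hψd]
    exact hrefl.1.2 i
  refine ⟨(𝓜 K).classifyingMap T Pt, ?_, ?_⟩
  · -- `i₀ ≫ σ = s′`: `Q` is a pull-back of `Pt` along `i₀` (level clause through `HQ ≫ pr₁ = H`)
    rw [← hclsQ]
    refine (𝓜 K).classifyingMap_comp i₀ Pt Q (G := H) (Ĝ := Ĥ) ⟨⟨hfib.1.1, fun i => ?_⟩, hfib.2.1,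
      hfib.2.2.1, hfib.2.2.2⟩
    -- `(Q.level.σ i) ≫ H = i₀ ≫ ψ.σ i`
    have h1 : (χ₀.σ i).left = (Q.level.σ i).left ≫ HQ := by
      rw [hχ₀ i, Over.comp_left, heQ]
      rfl
    have h2 : (χ₀.σ i).left ≫ pullback.fst P'.A.X.hom i₀.left = i₀.left ≫ (ψ.σ i).left := by
      rw [← hψ, LevelStructure.baseChange_σ]
      exact AbelianSchemeOver.sectionBaseChange_left_comp_fst P'.A i₀.left (ψ.σ i)
    have h2' : ((Q.level.σ i).left ≫ HQ) ≫ pullback.fst P'.A.X.hom i₀.left = i₀.left ≫ (ψ.σ i).left := by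
      rw [← h1]; exact h2
    change (Q.level.σ i).left ≫ H = i₀.left ≫ (ψ.σ i).left
    rw [← hHQG]
    exact (Category.assoc _ _ _).symm.trans h2'
  · -- `σ ≫ tr = τ`
    rw [classifyingMap_comp_tr hg 𝓜 f T Pt, hPt, hclsP']

/-- **`tr` lifts `ℂ[ε]`-points** — the socket text of the (R4-δ) assembly: for the point
`pt : Spec ℂ ⟶ Spec ℂ[ε]` (the augmentation `ε ↦ 0`, a surjective closed immersion with square-zero
kernel), every `ℂ[ε]`-point `τ` of `𝓜_{K′}` whose closed point lifts to `s′ ∈ 𝓜_K(ℂ)` lifts to a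
`ℂ[ε]`-point `σ` of `𝓜_K` through `s′` over `τ`. [cite: MumfordFogartyKirwan1994, Ch. 7 §3
Theorem 7.9 (p. 139) and App. 7A (p. 235)] [cite: SGA1, Exp. I Cor. 5.6] -/
theorem exists_lift_dualNumber (hg : 0 < g)
    (𝓜 : ∀ K : SiegelLevel δ, SiegelFineModuliScheme g K.N δ) {K K' : SiegelLevel δ} (f : K ⟶ K')
    (pt : specOver ℚ ℂ ⟶ specOver ℚ ℂ[ε])
    (hpt : pt.left = Spec.map (CommRingCat.ofHom (TrivSqZeroExt.fstHom ℂ ℂ ℂ).toRingHom))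
    (s' : specOver ℚ ℂ ⟶ (𝓜 K).M) (τ : specOver ℚ ℂ[ε] ⟶ (𝓜 K').M)
    (h : pt ≫ τ = s' ≫ tr hg 𝓜 f) :
    ∃ σ : specOver ℚ ℂ[ε] ⟶ (𝓜 K).M, pt ≫ σ = s' ∧ σ ≫ tr hg 𝓜 f = τ := by
  haveI : IsLocallyNoetherian (specOver ℚ ℂ[ε]).left :=
    inferInstanceAs (IsLocallyNoetherian (Spec (.of ℂ[ε])))
  haveI : IsClosedImmersion pt.left := by
    rw [hpt]
    exact IsClosedImmersion.spec_of_surjective _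
      (Literature.AlgebraicGeometry.Morphisms.dualNumber_fst_surjective ℂ)
  haveI : Surjective pt.left := by
    rw [hpt]
    exact Literature.AlgebraicGeometry.Morphisms.surjective_specMap_of_ker_le_nilradical _
      (Literature.AlgebraicGeometry.Morphisms.dualNumber_fst_surjective ℂ)
      (Literature.AlgebraicGeometry.Morphisms.le_nilradical_of_isNilpotent
        ⟨2, Literature.AlgebraicGeometry.Morphisms.dualNumber_ker_fst_sq_eq_bot ℂ⟩)
  exact exists_lift_of_isClosedImmersion_of_surjective hg 𝓜 f pt s' τ h

end SiegelModuliTower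

end Literature.AlgebraicGeometry.ModuliOfAbelianVarieties
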